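import Summits.FinalStateConjecture.FinalStateConjecture.Theorems.StarvedNecksDiagonalRadii
import Literature.Geometry.Lorentzian.KerrHyperboloidalLeaves

/-!
# Route StarvedNecks — `SeamedChartsExhaust`: honest growing radii (repair for the re-typed summit)

The summit re-typing of 2026-08-16 (semantic-vacuity audit, §2.1 (B)) strengthened
`Summit.FinalStateConjecture.HasExhaustiveCharts`: the near-zone radii `Rᵢ` must now GROW,
`Rᵢ(τ) → ∞`, and be HONEST, `max (r₊(Mᵢ, aᵢ), 0) + 1 ≤ Rᵢ(τ)`, besides carrying the `C²`
certification (clause (i)) and the causal covering (clause (ii)).  The route's landed proof of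
`Theses.StarvedNecks.SeamedChartsExhaust` (item stmt-FinalStateConjecture-13551,
`Theorems/StarvedNecksSeamedChartsExhaust.lean`) produces clauses (i)–(ii) for the SEAMED radii `R`,
which are `≥ R₀ + 4` but need not grow.  This file supplies the upgrade used by the repaired proof:

* `hasExhaustiveCharts_of_covering` — if radii `R ≥ R₀ + 4`, `100 Mᵢ ≤ R₀`, carry clause (i) and
  clause (ii), then `HasExhaustiveCharts d` holds, witnessed by `R'ᵢ τ := max (Rᵢ τ) (Rgᵢ τ)` with
  `Rgᵢ → ∞` the diagonal radii (`DiagonalRadii`, item stmt-FinalStateConjecture-13552, proved) of the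
  STRUCTURE's own fixed-radius convergence `truncDeviationCk … ρ τ → 0` (monotone in `ρ`):
  the truncated deviation at the `max` of two radii is the `max` of the two deviations;
  `certifiedLate`, `certifiedSlab` and `J⁻` are monotone in the radii; and
  `max (r₊, 0) + 1 ≤ 2 Mᵢ + 1 ≤ R₀ + 4 ≤ Rᵢ ≤ R'ᵢ` (`r₊ ≤ 2M`, `0 < Mᵢ`).

Elementary (real analysis + set monotonicity); no field equation, no named fact.
References: M. Dafermos, G. Holzegel, I. Rodnianski, M. Taylor, arXiv:2104.08222, §1 (near zones
`{r ≤ R}`); B. O'Neill, *Semi-Riemannian geometry*, Academic Press 1983, Ch. 14, p. 403 (`J⁻` monotone).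
-/

noncomputable section

-- `Summit.FinalStateConjecture.FinalStateConjecture.…` is the tree's mandated namespace (summit = sub-problem).
set_option linter.dupNamespace false

open Set Filter Topology
open scoped ENNReal Topology
open Literature.Geometry.Lorentzian

namespace Summit.FinalStateConjecture.FinalStateConjecture.Theorems.SeamedChartsExhaust.HonestRadii

/-- **Honest radii upgrade** (re-typed `HasExhaustiveCharts`, audit 2026-08-16 (B): the near-zone
radii must grow, `Rᵢ(τ) → ∞`, and dominate the horizon radius, `max (r₊, 0) + 1 ≤ Rᵢ(τ)`).
If radii `R ≥ R₀ + 4` with `100 Mᵢ ≤ R₀` carry the `C²` certification (clause (i)) and the covering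
clause (ii), then so do the enlarged radii `R'ᵢ τ := max (Rᵢ τ) (Rgᵢ τ)`, where `Rgᵢ → ∞` are
diagonal radii (`DiagonalRadii`, item stmt-FinalStateConjecture-13552) of the structure's own
fixed-radius convergence `truncDeviationCk … ρ τ → 0` (monotone in `ρ`, `truncDeviationCk_mono`):
the truncated deviation at the `max` of two radii is the `max` of the deviations, `certifiedLate`,
`certifiedSlab` and `J⁻` are monotone in the radii, and `max (r₊, 0) + 1 ≤ 2Mᵢ + 1 ≤ R₀ + 4`
(`r₊ ≤ 2M`). DHRT arXiv:2104.08222, §1; O'Neill 1983, Ch. 14, p. 403. [folklore] -/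
theorem hasExhaustiveCharts_of_covering {𝓢 : Spacetime.{0} 4} {O : Set 𝓢.carrier}
    (d : FinalStateDecomposition 𝓢 O 2) (R : Fin d.N → ℝ → ℝ) (R₀ : ℝ)
    (hR₀ : ∀ i, 100 * d.mass i ≤ R₀) (hR : ∀ i s, R₀ + 4 ≤ R i s)
    (hcert : ∀ i, Tendsto (fun τ ↦ 𝓢.truncDeviationCk (d.background i) (d.chart i) 2 (R i τ) τ)
      atTop (𝓝 0))
    (hcov : ∀ τ₁ : ℝ, d.τ₀ < τ₁ →
      O \ certifiedLate d R τ₁ ⊆ 𝓢.metric.causalPast 𝓢.timeOrientation (certifiedSlab d R τ₁)) :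
    HasExhaustiveCharts d := by
  -- diagonal radii (route support `DiagonalRadii`, proved) for each hole's fixed-radius convergence
  have hdiag : ∀ a : ℝ → ℝ → ℝ≥0∞, (∀ τ, Monotone (fun ρ ↦ a ρ τ)) →
      (∀ ρ, Tendsto (fun τ ↦ a ρ τ) atTop (𝓝 0)) → ∃ Rg : ℝ → ℝ, Monotone Rg ∧ Continuous Rg ∧
        Tendsto Rg atTop atTop ∧ Tendsto (fun τ ↦ a (Rg τ) τ) atTop (𝓝 0) :=
    Theorems.DiagonalRadii.diagonalRadii_proof
  have hmono : ∀ i τ, Monotone (fun ρ ↦ 𝓢.truncDeviationCk (d.background i) (d.chart i) 2 ρ τ) :=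
    fun i τ ρ ρ' h ↦ 𝓢.truncDeviationCk_mono (d.background i) (d.chart i) 2 h τ
  have hRg : ∀ i, ∃ Rg : ℝ → ℝ, Tendsto Rg atTop atTop ∧
      Tendsto (fun τ ↦ 𝓢.truncDeviationCk (d.background i) (d.chart i) 2 (Rg τ) τ) atTop (𝓝 0) := by
    intro i
    obtain ⟨Rg, -, -, htop, hlim⟩ :=
      hdiag (fun ρ τ ↦ 𝓢.truncDeviationCk (d.background i) (d.chart i) 2 ρ τ) (hmono i)
        (d.tendsto_truncDeviationCk i)
    exact ⟨Rg, htop, hlim⟩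
  choose Rg hRg_top hRg_lim using hRg
  have hle : ∀ i τ, R i τ ≤ max (R i τ) (Rg i τ) := fun i τ ↦ le_max_left _ _
  refine ⟨fun i τ ↦ max (R i τ) (Rg i τ), fun i ↦ ⟨?_, fun τ ↦ ?_⟩, fun i ↦ ?_, fun τ₁ hτ₁ ↦ ?_⟩
  · -- the enlarged radii grow: `R' ≥ Rg → ∞`
    exact tendsto_atTop_mono (fun τ ↦ le_max_right _ _) (hRg_top i)
  · -- honest: `max (r₊, 0) + 1 ≤ 2M + 1 ≤ R₀ + 4 ≤ R ≤ R'`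
    have hM : 0 < d.mass i := d.mass_pos i
    have h2M : Kerr.rPlus (d.mass i) (d.spin i) ≤ 2 * d.mass i := Kerr.rPlus_le_two_mul hM.le
    have hmax : max (Kerr.rPlus (d.mass i) (d.spin i)) 0 ≤ 2 * d.mass i := max_le h2M (by linarith)
    calc max (Kerr.rPlus (d.mass i) (d.spin i)) 0 + 1 ≤ R₀ + 4 := by linarith [hR₀ i]
      _ ≤ R i τ := hR i τ
      _ ≤ max (R i τ) (Rg i τ) := hle i τ
  · -- certification at `R'`: the deviation at `max` of two radii is the `max` of the deviations
    have heq : (fun τ ↦ 𝓢.truncDeviationCk (d.background i) (d.chart i) 2 (max (R i τ) (Rg i τ)) τ) =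
        fun τ ↦ max (𝓢.truncDeviationCk (d.background i) (d.chart i) 2 (R i τ) τ)
          (𝓢.truncDeviationCk (d.background i) (d.chart i) 2 (Rg i τ) τ) := by
      funext τ
      exact (hmono i τ).map_max
    rw [heq]
    simpa using (hcert i).max (hRg_lim i)
  · -- covering at `R'`: `certifiedLate`, `certifiedSlab` and `J⁻` are monotone in the radii
    have hlate : certifiedLate d R τ₁ ⊆ certifiedLate d (fun i τ ↦ max (R i τ) (Rg i τ)) τ₁ := by
      refine union_subset_union_right _ (iUnion_mono fun i ↦ image_mono ?_)
      intro x hx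
      exact ⟨hx.1, hx.2.trans (hle i _)⟩
    have hslab : certifiedSlab d R τ₁ ⊆ certifiedSlab d (fun i τ ↦ max (R i τ) (Rg i τ)) τ₁ :=
      union_subset_union_right _ (iUnion_mono fun i ↦
        image_mono ((d.background i).truncTimeSlab_mono (hle i τ₁) τ₁))
    have hJ : 𝓢.metric.causalPast 𝓢.timeOrientation (certifiedSlab d R τ₁) ⊆
        𝓢.metric.causalPast 𝓢.timeOrientation
          (certifiedSlab d (fun i τ ↦ max (R i τ) (Rg i τ)) τ₁) :=
      LorentzianMetric.causalFuture_mono hslab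
    intro p hp
    exact hJ (hcov τ₁ hτ₁ ⟨hp.1, fun h ↦ hp.2 (hlate h)⟩)

end Summit.FinalStateConjecture.FinalStateConjecture.Theorems.SeamedChartsExhaust.HonestRadii

end
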